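import Mathlib.Algebra.MvPolynomial.PDeriv
import Mathlib.LinearAlgebra.Matrix.Permutation
import Literature.Computability.AlgebraicComplexity.DeterminantalComplexityProofs

/-!
# Route `PolyaContinued`, crux `FreeEdgeAdditivity` (stmt-ValiantsHypothesis-7423) — peeling one
# rank-one free variable (tools)

SPECIAL CASE tools only; `FreeEdgeAdditivity` NOT proved; the crux is NOT in the route's closes-cone
(route text l.193: the assembly does not use it).

ROUTE-INDEPENDENT support file (`--supports stmt-ValiantsHypothesis-7423`; no `Theses` import, so route
edits do not rebuild it), part 1 of 2 (part 2:
`PolyaContinuedFreeEdgeRankOne.lean`, the additivity theorem for rank-one attachments).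

* `eq_of_rename_add_X_mul`: cancellation `p + y·q = y·r ⇒ p = 0 ∧ q = r` for `p, q, r` free of the
  variable `y` (renamed along an injection missing `y`; proof by `∂/∂y`).
* `exists_isUnit_mulVec_eq_single`: over a field a nonzero vector is `P⁻¹ e₀` for an invertible `P`.
* `det_add_smul_vecMulVec_single`: `det (R + y · e₀ e₀ᵀ) = det R + y · det (minor₀₀ R)`.
* `peel`: if `det (N + y · u vᵀ) = y · G` with `N, G` free of `y`, `u, v` constant and `G ≠ 0`,
  then `G = c · det (minor₀₀ (P N Q))` for constant invertible `P, Q` and a constant `c ≠ 0`.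

HONEST FRAMING: linear-algebra plumbing for a partial result on an open crux; nothing here bears on
`VP ≠ VNP`.

## References

* [MignonRessayre2004] T. Mignon, N. Ressayre, *A quadratic bound for the determinant and
  permanent problem*, IMRN 2004, §1 (affine determinantal representations).
-/

noncomputable section

-- `Summit.<Summit>.<Problem>` repeats `ValiantsHypothesis` by the tree's layout convention (D-0017).
set_option linter.dupNamespace false

namespace Summit.ValiantsHypothesis.ValiantsHypothesis.Theorems.PolyaContinued.FreeEdgeRankOne

open MvPolynomial Matrix Literature.Computability.AlgebraicComplexity

section Cancel

variable {k : Type*} [Field k] {τ τ' : Type*}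

/-- A polynomial renamed along `ι` does not involve a variable outside the range of `ι`, so its
partial derivative there vanishes. [folklore] -/
theorem pderiv_rename_eq_zero {ι : τ → τ'} {y : τ'} (hy : y ∉ Set.range ι) (p : MvPolynomial τ k) :
    pderiv y (rename ι p) = 0 := by
  classical
  refine pderiv_eq_zero_of_notMem_vars fun hmem => hy ?_
  obtain ⟨x, -, hx⟩ := Finset.mem_image.mp (vars_rename ι p hmem)
  exact ⟨x, hx⟩

/-- Cancellation in a distinguished variable: if `p + y·q = y·r` with `p, q, r` free of the
variable `y` (they are renamed along an injection `ι` missing `y`), then `p = 0` and `q = r`.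
[folklore] -/
theorem eq_of_rename_add_X_mul {ι : τ → τ'} (hι : Function.Injective ι) {y : τ'}
    (hy : y ∉ Set.range ι) {p q r : MvPolynomial τ k}
    (h : rename ι p + X y * rename ι q = X y * rename ι r) :
    p = 0 ∧ q = r := by
  have hqr : q = r := by
    have h' := congrArg (pderiv y) h
    simp only [Derivation.leibniz, map_add, pderiv_X_self, pderiv_rename_eq_zero hy,
      zero_add, smul_eq_mul, mul_one] at h'
    exact rename_injective ι hι (by simpa using h')
  subst hqr
  refine ⟨rename_injective ι hι ?_, rfl⟩
  have : rename ι p = 0 := by simpa using h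
  simpa using this

end Cancel

section Normalise

variable {k : Type*} [Field k]

/-- Over a field, a nonzero vector is the image of the first basis vector under an invertible
matrix: `P *ᵥ u = e₀` for some `P` with `det P` a unit. [folklore] -/
theorem exists_isUnit_mulVec_eq_single {m : ℕ} (u : Fin (m + 1) → k) (hu : u ≠ 0) :
    ∃ P : Matrix (Fin (m + 1)) (Fin (m + 1)) k, IsUnit P.det ∧ P *ᵥ u = Pi.single 0 1 := by
  obtain ⟨i₁, hi₁⟩ : ∃ i, u i ≠ 0 := by
    by_contra h
    push Not at h
    exact hu (funext h)
  -- permutation bringing `i₁` to `0`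
  set S : Matrix (Fin (m + 1)) (Fin (m + 1)) k := (Equiv.swap 0 i₁).permMatrix k with hS
  set w : Fin (m + 1) → k := S *ᵥ u with hw
  have hw0 : w 0 = u i₁ := by
    rw [hw, hS, Matrix.permMatrix_mulVec]
    simp
  -- `B = 1` with column `0` replaced by `w`
  set B : Matrix (Fin (m + 1)) (Fin (m + 1)) k := (1 : Matrix _ _ k).updateCol 0 w with hB
  have hBdet : B.det = w 0 := by
    rw [hB, ← Matrix.cramer_apply, Matrix.cramer_one]
    simp
  have hBunit : IsUnit B.det := by
    rw [hBdet, hw0]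
    exact isUnit_iff_ne_zero.mpr hi₁
  have hBe : B *ᵥ Pi.single 0 1 = w := by
    rw [Matrix.mulVec_single_one]
    funext i
    simp [hB]
  refine ⟨B⁻¹ * S, ?_, ?_⟩
  · rw [Matrix.det_mul, hS, Matrix.det_permutation]
    refine (Matrix.isUnit_nonsing_inv_det B hBunit).mul ?_
    refine isUnit_iff_ne_zero.mpr ?_
    rcases Int.units_eq_one_or (Equiv.Perm.sign (Equiv.swap 0 i₁)) with h1 | h1 <;> simp [h1]
  · rw [← Matrix.mulVec_mulVec, ← hw, ← hBe, Matrix.mulVec_mulVec,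
      Matrix.nonsing_inv_mul B hBunit, Matrix.one_mulVec]

/-- Row version: `v ᵥ* Q = e₀` for some `Q` with `det Q` a unit. [folklore] -/
theorem exists_isUnit_vecMul_eq_single {m : ℕ} (v : Fin (m + 1) → k) (hv : v ≠ 0) :
    ∃ Q : Matrix (Fin (m + 1)) (Fin (m + 1)) k, IsUnit Q.det ∧ v ᵥ* Q = Pi.single 0 1 := by
  obtain ⟨P, hP, hPu⟩ := exists_isUnit_mulVec_eq_single v hv
  exact ⟨Pᵀ, by rwa [Matrix.det_transpose], by rwa [Matrix.vecMul_transpose]⟩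

end Normalise

section Peel

variable {k : Type*} [Field k] {τ τ' : Type*}

/-- Conjugating an outer product: `P ⬝ (u vᵀ) ⬝ Q = (P u) (v Q)ᵀ`. [folklore] -/
theorem mul_vecMulVec_mul {n : Type*} [Fintype n] (P Q : Matrix n n k) (u v : n → k) :
    P * vecMulVec u v * Q = vecMulVec (P *ᵥ u) (v ᵥ* Q) := by
  rw [Matrix.mul_vecMulVec, Matrix.vecMulVec_mul]

/-- Row-`0` expansion against the first basis vector: replacing row `0` of `R` by `e₀` leaves the
determinant of the complementary principal minor. [folklore] -/
theorem det_updateRow_zero_single {m : ℕ} {S : Type*} [CommRing S]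
    (R : Matrix (Fin (m + 1)) (Fin (m + 1)) S) :
    (R.updateRow 0 (Pi.single 0 1)).det = (R.submatrix Fin.succ Fin.succ).det := by
  rw [Matrix.det_succ_row_zero, Finset.sum_eq_single (0 : Fin (m + 1))]
  · have hsub : (R.updateRow 0 (Pi.single 0 1)).submatrix Fin.succ Fin.succ =
        R.submatrix Fin.succ Fin.succ := by
      ext i j
      simp
    simp [Matrix.updateRow_self, Fin.succAbove_zero, hsub]
  · intro j _ hj
    simp [Matrix.updateRow_self, Pi.single_eq_of_ne hj]
  · simp

/-- Adding `y` times the elementary matrix `e₀ e₀ᵀ` to `R`: the determinant is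
`det R + y · det (minor₀₀ R)` (linearity in row `0`). [folklore] -/
theorem det_add_smul_vecMulVec_single {m : ℕ} {S : Type*} [CommRing S]
    (R : Matrix (Fin (m + 1)) (Fin (m + 1)) S) (y : S) :
    (R + y • vecMulVec (Pi.single 0 1) (Pi.single 0 1)).det =
      R.det + y * (R.submatrix Fin.succ Fin.succ).det := by
  have hupd : R + y • vecMulVec (Pi.single 0 1) (Pi.single 0 1) =
      R.updateRow 0 (R 0 + y • (Pi.single 0 1 : Fin (m + 1) → S)) := by
    ext i j
    by_cases hi : i = 0
    · subst hi
      simp [Matrix.updateRow_self, vecMulVec_apply, Pi.single_apply]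
    · simp [vecMulVec_apply, Pi.single_apply, hi]
  rw [hupd, Matrix.det_updateRow_add, Matrix.updateRow_eq_self, Matrix.det_updateRow_smul,
    det_updateRow_zero_single]

/-- **Peeling one rank-one free variable.** If `det (N + y · u vᵀ) = y · G` with `N`, `G` free
of the distinguished variable `y` (they come from `MvPolynomial τ k` by renaming along an
injection `ι : τ → τ'` whose range misses `y`), `u, v` constant vectors and `G ≠ 0`, then `G` is,
up to a nonzero constant, the determinant of a principal minor (size one less) of a CONSTANT
two-sided conjugate `P N Q` of `N`. [folklore] -/
theorem peel {ι : τ → τ'} (hι : Function.Injective ι) {y : τ'} (hy : y ∉ Set.range ι)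
    {m : ℕ} (N : Matrix (Fin (m + 1)) (Fin (m + 1)) (MvPolynomial τ k))
    (u v : Fin (m + 1) → k) (G : MvPolynomial τ k) (hG : G ≠ 0)
    (h : (N.map (rename ι) + (X y : MvPolynomial τ' k) • (vecMulVec u v).map C).det =
      X y * rename ι G) :
    ∃ (P Q : Matrix (Fin (m + 1)) (Fin (m + 1)) k) (c : k), IsUnit P.det ∧ IsUnit Q.det ∧ c ≠ 0 ∧
      G = C c * ((P.map C * N * Q.map C).submatrix Fin.succ Fin.succ).det := by
  have hdetN : (N.map (rename ι)).det = rename ι N.det := by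
    rw [← AlgHom.mapMatrix_apply, ← AlgHom.map_det]
  -- `u ≠ 0` and `v ≠ 0`: otherwise the left-hand side is free of `y`
  have huv : u ≠ 0 ∧ v ≠ 0 := by
    by_contra h0
    have hz : vecMulVec u v = 0 := by
      rcases not_and_or.mp h0 with h0 | h0 <;>
      · push Not at h0
        subst h0
        ext i j
        simp [vecMulVec_apply]
    rw [hz, Matrix.map_zero _ (map_zero C), smul_zero, add_zero, hdetN] at h
    have := (eq_of_rename_add_X_mul hι hy (p := N.det) (q := 0) (r := G) (by simpa using h)).2
    exact hG this.symm
  obtain ⟨P, hP, hPu⟩ := exists_isUnit_mulVec_eq_single u huv.1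
  obtain ⟨Q, hQ, hQv⟩ := exists_isUnit_vecMul_eq_single v huv.2
  -- conjugate the identity by the constant matrices `P`, `Q`
  set CO : k →+* MvPolynomial τ' k := C with hCO
  set N' : Matrix (Fin (m + 1)) (Fin (m + 1)) (MvPolynomial τ k) := P.map C * N * Q.map C with hN'
  have hmapP : (P.map (C : k →+* MvPolynomial τ k)).map (rename ι) = P.map CO := by
    rw [Matrix.map_map]; congr 1; funext a; simp [hCO]
  have hmapQ : (Q.map (C : k →+* MvPolynomial τ k)).map (rename ι) = Q.map CO := by
    rw [Matrix.map_map]; congr 1; funext a; simp [hCO]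
  have hconj : P.map CO * (N.map (rename ι) + (X y : MvPolynomial τ' k) •
      (vecMulVec u v).map CO) * Q.map CO =
      N'.map (rename ι) + (X y : MvPolynomial τ' k) •
        vecMulVec (Pi.single 0 1) (Pi.single 0 1) := by
    rw [Matrix.mul_add, Matrix.add_mul, Matrix.mul_smul, Matrix.smul_mul, ← Matrix.map_mul,
      ← Matrix.map_mul, mul_vecMulVec_mul, hPu, hQv, hN', Matrix.map_mul, Matrix.map_mul, hmapP,
      hmapQ]
    congr 2
    ext i j
    simp only [Matrix.map_apply, vecMulVec_apply, Pi.single_apply, hCO]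
    split_ifs <;> simp
  have hdet := congrArg Matrix.det hconj
  have hsubmap : (N'.map (rename ι)).submatrix Fin.succ Fin.succ =
      (N'.submatrix Fin.succ Fin.succ).map (rename ι) := by
    rw [Matrix.submatrix_map]
  rw [Matrix.det_mul, Matrix.det_mul, h, det_add_smul_vecMulVec_single, hsubmap,
    ← AlgHom.mapMatrix_apply, ← AlgHom.mapMatrix_apply, ← AlgHom.map_det,
    ← AlgHom.map_det, ← RingHom.mapMatrix_apply, ← RingHom.mapMatrix_apply, ← RingHom.map_det,
    ← RingHom.map_det] at hdet
  have hc : CO P.det * (X y * rename ι G) * CO Q.det =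
      X y * rename ι (C (P.det * Q.det) * G) := by
    simp only [hCO, map_mul, rename_C]
    ring
  rw [hc] at hdet
  have hq := (eq_of_rename_add_X_mul hι hy hdet.symm).2
  have hc0 : P.det * Q.det ≠ 0 := (hP.mul hQ).ne_zero
  refine ⟨P, Q, (P.det * Q.det)⁻¹, hP, hQ, inv_ne_zero hc0, ?_⟩
  rw [← hN', hq, ← mul_assoc, ← map_mul, inv_mul_cancel₀ hc0, map_one, one_mul]

end Peel

end Summit.ValiantsHypothesis.ValiantsHypothesis.Theorems.PolyaContinued.FreeEdgeRankOne

end
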